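import Summits.AtomisticToContinuum.FouriersLaw.Theses.CoercivePulse
import Summits.AtomisticToContinuum.FouriersLaw.Theorems.EmbeddedDrudeMourreGreenKuboContinuationCurrentVariancePos
import Literature.MathematicalPhysics.KineticTheory.InfiniteChainGibbsInvariance
import Literature.MathematicalPhysics.KineticTheory.InfiniteChainShiftInvariantUniqueness
import Literature.MathematicalPhysics.KineticTheory.InfiniteChainSuperstableReversal
import Literature.MathematicalPhysics.KineticTheory.InfiniteChainGibbsExistenceShift
import Literature.MathematicalPhysics.KineticTheory.InfiniteChainPartialMomentumReversal
import Literature.MathematicalPhysics.KineticTheory.InfiniteChainCurrentMoments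
import Literature.MathematicalPhysics.KineticTheory.InfiniteChainObservables

/-!
# `AbelRegularity` / Negative: positive type alone does not forbid oscillating Abel means

Support file (`--supports stmt-AtomisticToContinuum-15384`) of the crux-attack (vetting) seat of the crux
`CoercivePulse.AbelRegularity` (stmt-AtomisticToContinuum-15384; shared verbatim with
`HoelderEscapeProfile.AbelRegularity`): "the Abel means `A(ν) = ∫₀^∞ e^{-νt} C_T(t) dt` of the summed current
autocorrelation of a guarded `(μ_T, D)` converge in `ℝ` or tend to `+∞` as `ν ↓ 0`".  The crux is NOT refuted (it
is the zero-frequency regularity of the current spectral measure of a deterministic anharmonic chain, open).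

What this file lands, importably, is the Lean form of the crux's recorded failure mode and of the planner's remark
that the registered line `birth` (S1 `stub_spectralStieltjes` + S3 `stub_fatouRadialPoisson`) does not give the crux
without its physics stub S2: by S1 the Abel means are the Poisson means `ν ↦ ∫ ν/(ν²+ω²) dρ(ω)` of a FINITE POSITIVE
measure `ρ` (the current spectral measure), and

* `exists_isFiniteMeasure_poissonMeans_oscillate` — there is a finite positive Borel measure `ρ` on `ℝ` whose
  Poisson means NEITHER converge in `ℝ` NOR tend to `+∞` as `ν ↓ 0` (they oscillate): `ρ` = Lebesgue measure
  restricted to the lacunary shells `⋃ₖ [q^{2k+1}, q^{2k}]`, `q = 1/256`; along `ν = q^{2k}/16` the means are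
  `≥ π/2 - 1/8`, along `ν = q^{2k+1}/16` they are `≤ 1/8` (`poissonMeans_lacunary_ge`, `poissonMeans_lacunary_le`);
* `not_poissonMeans_dichotomy` — hence the NATURAL STRENGTHENING of the crux "every finite positive measure has
  non-oscillating Poisson means at `0`" (= the crux with everything chain-specific replaced by positive type of
  `C_T`) is FALSE;
* `abelRegularity_false_without_carrierAE` (§5, LOAD-BEARING HYPOTHESIS) — the crux with `D.PreservesMeasure μ`
  weakened to its second clause "every `φ_t` preserves `μ`" (dropping "`μ`-a.e. point lies in the carrier", the
  only clause tying the flow to Newton's equations) is FALSE: at `ω₂ = lam = β = γ = T = 1` the frozen dynamics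
  `φ_t = R` (momentum reversal, empty carrier) preserves the (reversal-invariant) DLR state, commutes with the
  shift, has absolutely convergent correlations `C ≡ -c₀` with `c₀ = C_T(0) > 0` the static current variance of
  the genuine chain (`stub_currentVariancePos`, landed), and Abel means `-c₀/ν → -∞`.

Consequence: a proof must use (i) that a.e. orbit solves the equations of motion (§5) and (ii) zero-frequency
information on THE current spectral measure beyond positivity/finiteness (S2, a limiting-absorption estimate, an
eventual sign of `C_T`); a refutation needs lacunary spectral mass of the GENUINE chain.  No new definitions.
Refuter seat refuter-rattack-stmt-AtomisticToContinuum-15384-0, 2026-08-17.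
-/

noncomputable section

namespace Summit.AtomisticToContinuum.FouriersLaw.Theorems.AbelRegularity.Negative

open MeasureTheory Set Filter Topology
open Literature.MathematicalPhysics.KineticTheory.HeatConduction

/-! ## §1 The Poisson kernel `ν/(ν²+ω²)` on intervals -/

/-- `ν/(ν²+ω²) = ν⁻¹ (1 + (ω/ν)²)⁻¹` for `ν ≠ 0`. [folklore] -/
theorem poissonKernel_eq {ν : ℝ} (hν : ν ≠ 0) (ω : ℝ) :
    ν / (ν ^ 2 + ω ^ 2) = ν⁻¹ * (1 + (ω / ν) ^ 2)⁻¹ := by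
  have h1 : ν ^ 2 + ω ^ 2 ≠ 0 := by positivity
  field_simp

/-- The Poisson kernel is continuous in `ω` for `ν > 0`. [folklore] -/
theorem continuous_poissonKernel {ν : ℝ} (hν : 0 < ν) : Continuous fun ω : ℝ => ν / (ν ^ 2 + ω ^ 2) :=
  continuous_const.div (by fun_prop) fun ω => by positivity

/-- The Poisson kernel is non-negative for `ν ≥ 0`. [folklore] -/
theorem poissonKernel_nonneg {ν : ℝ} (hν : 0 ≤ ν) (ω : ℝ) : 0 ≤ ν / (ν ^ 2 + ω ^ 2) := by positivity

/-- `∫_a^b ν/(ν²+ω²) dω = arctan(b/ν) - arctan(a/ν)` (`ν > 0`). [folklore] -/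
theorem intervalIntegral_poissonKernel {ν : ℝ} (hν : 0 < ν) (a b : ℝ) :
    ∫ ω in a..b, ν / (ν ^ 2 + ω ^ 2) = Real.arctan (b / ν) - Real.arctan (a / ν) := by
  have h : (fun ω : ℝ => ν / (ν ^ 2 + ω ^ 2)) =
      fun ω => ν⁻¹ * (fun x : ℝ => (1 + x ^ 2)⁻¹) (ω / ν) :=
    funext fun ω => poissonKernel_eq hν.ne' ω
  rw [h, intervalIntegral.integral_const_mul,
    intervalIntegral.integral_comp_div (fun x : ℝ => (1 + x ^ 2)⁻¹) hν.ne', smul_eq_mul,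
    integral_inv_one_add_sq]
  field_simp

/-- `∫_{[a,b]} ν/(ν²+ω²) dω = arctan(b/ν) - arctan(a/ν)` (`ν > 0`, `a ≤ b`). [folklore] -/
theorem setIntegral_Icc_poissonKernel {ν a b : ℝ} (hν : 0 < ν) (hab : a ≤ b) :
    ∫ ω in Icc a b, ν / (ν ^ 2 + ω ^ 2) = Real.arctan (b / ν) - Real.arctan (a / ν) := by
  rw [integral_Icc_eq_integral_Ioc, ← intervalIntegral.integral_of_le hab,
    intervalIntegral_poissonKernel hν]

/-- `∫_{(a,b]} ν/(ν²+ω²) dω = arctan(b/ν) - arctan(a/ν)` (`ν > 0`, `a ≤ b`). [folklore] -/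
theorem setIntegral_Ioc_poissonKernel {ν a b : ℝ} (hν : 0 < ν) (hab : a ≤ b) :
    ∫ ω in Ioc a b, ν / (ν ^ 2 + ω ^ 2) = Real.arctan (b / ν) - Real.arctan (a / ν) := by
  rw [← intervalIntegral.integral_of_le hab, intervalIntegral_poissonKernel hν]

/-! ## §2 The lacunary shells `⋃ₖ [q^{2k+1}, q^{2k}]`, `q = 1/256` -/

/-- The shells lie in `[0, 1]`. [folklore] -/
theorem lacunaryShells_subset_Icc :
    (⋃ k : ℕ, Icc ((1 / 256 : ℝ) ^ (2 * k + 1)) ((1 / 256 : ℝ) ^ (2 * k))) ⊆ Icc 0 1 := by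
  intro ω hω
  obtain ⟨k, hk⟩ := mem_iUnion.1 hω
  exact ⟨(pow_pos (by norm_num) _).le.trans hk.1, hk.2.trans (pow_le_one₀ (by norm_num) (by norm_num))⟩

/-- The shells form a measurable set. [folklore] -/
theorem measurableSet_lacunaryShells :
    MeasurableSet (⋃ k : ℕ, Icc ((1 / 256 : ℝ) ^ (2 * k + 1)) ((1 / 256 : ℝ) ^ (2 * k))) :=
  MeasurableSet.iUnion fun _ => measurableSet_Icc

/-- Lebesgue measure restricted to the shells is a finite measure (mass `≤ 1`). [folklore] -/
theorem isFiniteMeasure_restrict_lacunaryShells :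
    IsFiniteMeasure ((volume : Measure ℝ).restrict
      (⋃ k : ℕ, Icc ((1 / 256 : ℝ) ^ (2 * k + 1)) ((1 / 256 : ℝ) ^ (2 * k)))) := by
  refine isFiniteMeasure_restrict.2 (ne_of_lt ?_)
  calc (volume : Measure ℝ) (⋃ k : ℕ, Icc ((1 / 256 : ℝ) ^ (2 * k + 1)) ((1 / 256 : ℝ) ^ (2 * k)))
      ≤ volume (Icc (0 : ℝ) 1) := measure_mono lacunaryShells_subset_Icc
    _ < ⊤ := by rw [Real.volume_Icc]; exact ENNReal.ofReal_lt_top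

/-- For `ν' = q^{2k+1}/16` the shells lie in `(0, q^{2k+2}] ∪ [q^{2k+1}, 1]`: the shells of index `≥ k+1` below,
those of index `≤ k` above. [folklore] -/
theorem lacunaryShells_subset_union (k : ℕ) :
    (⋃ j : ℕ, Icc ((1 / 256 : ℝ) ^ (2 * j + 1)) ((1 / 256 : ℝ) ^ (2 * j))) ⊆
      Ioc 0 ((1 / 256 : ℝ) ^ (2 * k + 2)) ∪ Icc ((1 / 256 : ℝ) ^ (2 * k + 1)) 1 := by
  intro ω hω
  obtain ⟨j, hj⟩ := mem_iUnion.1 hω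
  rcases le_or_gt j k with hjk | hjk
  · refine Or.inr ⟨?_, hj.2.trans (pow_le_one₀ (by norm_num) (by norm_num))⟩
    exact (pow_le_pow_of_le_one (by norm_num) (by norm_num) (by omega)).trans hj.1
  · refine Or.inl ⟨(pow_pos (by norm_num) _).trans_le hj.1, ?_⟩
    exact hj.2.trans (pow_le_pow_of_le_one (by norm_num) (by norm_num) (by omega))

/-! ## §3 Two-sided bounds on the Poisson means along two sequences -/

/-- Along `ν = q^{2k}/16` (deep inside the `k`-th shell in logarithmic scale) the Poisson means of the shell
measure are `≥ arctan 16 - arctan (1/16) ≥ π/2 - 1/8`. [folklore] -/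
theorem poissonMeans_lacunary_ge (k : ℕ) :
    Real.pi / 2 - 1 / 8 ≤
      ∫ ω in (⋃ j : ℕ, Icc ((1 / 256 : ℝ) ^ (2 * j + 1)) ((1 / 256 : ℝ) ^ (2 * j))),
        ((1 / 16 : ℝ) * (1 / 256 : ℝ) ^ (2 * k)) /
          (((1 / 16 : ℝ) * (1 / 256 : ℝ) ^ (2 * k)) ^ 2 + ω ^ 2) := by
  set ν : ℝ := (1 / 16 : ℝ) * (1 / 256 : ℝ) ^ (2 * k) with hν_def
  have hq0 : (0 : ℝ) < (1 / 256 : ℝ) ^ (2 * k) := pow_pos (by norm_num) _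
  have hν : 0 < ν := by positivity
  -- the `k`-th shell alone
  have hshell : Icc ((1 / 256 : ℝ) ^ (2 * k + 1)) ((1 / 256 : ℝ) ^ (2 * k)) ⊆
      ⋃ j : ℕ, Icc ((1 / 256 : ℝ) ^ (2 * j + 1)) ((1 / 256 : ℝ) ^ (2 * j)) :=
    subset_iUnion (fun j : ℕ => Icc ((1 / 256 : ℝ) ^ (2 * j + 1)) ((1 / 256 : ℝ) ^ (2 * j))) k
  have hab : (1 / 256 : ℝ) ^ (2 * k + 1) ≤ (1 / 256 : ℝ) ^ (2 * k) :=
    pow_le_pow_of_le_one (by norm_num) (by norm_num) (by omega)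
  have hint : IntegrableOn (fun ω : ℝ => ν / (ν ^ 2 + ω ^ 2))
      (⋃ j : ℕ, Icc ((1 / 256 : ℝ) ^ (2 * j + 1)) ((1 / 256 : ℝ) ^ (2 * j))) volume :=
    ((continuous_poissonKernel hν).integrableOn_Icc (a := (0 : ℝ)) (b := 1)).mono_set
      lacunaryShells_subset_Icc
  have hmono := setIntegral_mono_set (μ := (volume : Measure ℝ)) hint
    (Eventually.of_forall fun ω => poissonKernel_nonneg hν.le ω) hshell.eventuallyLE
  have hval : ∫ ω in Icc ((1 / 256 : ℝ) ^ (2 * k + 1)) ((1 / 256 : ℝ) ^ (2 * k)), ν / (ν ^ 2 + ω ^ 2) =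
      Real.arctan 16 - Real.arctan (1 / 16) := by
    rw [setIntegral_Icc_poissonKernel hν hab]
    have e1 : (1 / 256 : ℝ) ^ (2 * k) / ν = 16 := by
      rw [hν_def, div_mul_eq_div_div_swap, div_self hq0.ne']
      norm_num
    have e2 : (1 / 256 : ℝ) ^ (2 * k + 1) / ν = 1 / 16 := by
      rw [hν_def, pow_succ, mul_comm ((1 / 256 : ℝ) ^ (2 * k)) (1 / 256), mul_div_mul_right _ _ hq0.ne']
      norm_num
    rw [e1, e2]
  have harc : Real.arctan 16 = Real.pi / 2 - Real.arctan (1 / 16) := by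
    rw [← Real.arctan_inv_of_pos (show (0 : ℝ) < 1 / 16 by norm_num)]
    norm_num
  have hsmall : Real.arctan (1 / 16) ≤ 1 / 16 := by
    -- `arctan x ≤ x` for `x ≥ 0` (as `Literature.NumberTheory.LFunctions.arctan_le_self`, inlined to keep the
    -- import closure of this file inside the heat-conduction cone)
    have h1 : 0 ≤ Real.arctan (1 / 16) := Real.arctan_nonneg.2 (by norm_num)
    have h2 := Real.le_tan h1 (Real.arctan_lt_pi_div_two _)
    rwa [Real.tan_arctan] at h2
  rw [hval] at hmono
  linarith

/-- Along `ν' = q^{2k+1}/16` (deep inside the `k`-th GAP in logarithmic scale) the Poisson means of the shell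
measure are `≤ 2 arctan (1/16) ≤ 1/8`. [folklore] -/
theorem poissonMeans_lacunary_le (k : ℕ) :
    ∫ ω in (⋃ j : ℕ, Icc ((1 / 256 : ℝ) ^ (2 * j + 1)) ((1 / 256 : ℝ) ^ (2 * j))),
        ((1 / 16 : ℝ) * (1 / 256 : ℝ) ^ (2 * k + 1)) /
          (((1 / 16 : ℝ) * (1 / 256 : ℝ) ^ (2 * k + 1)) ^ 2 + ω ^ 2) ≤ 1 / 8 := by
  set ν : ℝ := (1 / 16 : ℝ) * (1 / 256 : ℝ) ^ (2 * k + 1) with hν_def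
  have hq0 : (0 : ℝ) < (1 / 256 : ℝ) ^ (2 * k + 1) := pow_pos (by norm_num) _
  have hν : 0 < ν := by positivity
  set c : ℝ := (1 / 256 : ℝ) ^ (2 * k + 2) with hc_def
  set d : ℝ := (1 / 256 : ℝ) ^ (2 * k + 1) with hd_def
  have hc0 : 0 ≤ c := (pow_pos (by norm_num) _).le
  have hcd : c < d := pow_lt_pow_right_of_lt_one₀ (by norm_num) (by norm_num) (by omega)
  have hd1 : d ≤ 1 := pow_le_one₀ (by norm_num) (by norm_num)
  have hd0 : 0 ≤ d := hq0.le
  -- enlarge the domain to `(0, c] ∪ [d, 1]`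
  have hT01 : Ioc 0 c ∪ Icc d 1 ⊆ Icc (0 : ℝ) 1 := by
    rintro ω (⟨h1, h2⟩ | ⟨h1, h2⟩)
    · exact ⟨h1.le, h2.trans (hcd.le.trans hd1)⟩
    · exact ⟨hd0.trans h1, h2⟩
  have hcont := continuous_poissonKernel hν
  have hintT : IntegrableOn (fun ω : ℝ => ν / (ν ^ 2 + ω ^ 2)) (Ioc 0 c ∪ Icc d 1) volume :=
    (hcont.integrableOn_Icc (a := (0 : ℝ)) (b := 1)).mono_set hT01
  have hmono := setIntegral_mono_set (μ := (volume : Measure ℝ)) hintT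
    (Eventually.of_forall fun ω => poissonKernel_nonneg hν.le ω) (lacunaryShells_subset_union k).eventuallyLE
  have hdisj : Disjoint (Ioc (0 : ℝ) c) (Icc d 1) :=
    Set.disjoint_left.2 fun ω h1 h2 => absurd (h2.1.trans h1.2) (not_le.2 hcd)
  have hsplit : ∫ ω in Ioc 0 c ∪ Icc d 1, ν / (ν ^ 2 + ω ^ 2) =
      (∫ ω in Ioc 0 c, ν / (ν ^ 2 + ω ^ 2)) + ∫ ω in Icc d 1, ν / (ν ^ 2 + ω ^ 2) :=
    setIntegral_union hdisj measurableSet_Icc (hcont.integrableOn_Icc.mono_set Ioc_subset_Icc_self)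
      hcont.integrableOn_Icc
  have e3 : d / ν = 16 := by
    rw [hν_def, hd_def, div_mul_eq_div_div_swap, div_self hq0.ne']
    norm_num
  have e4 : c / ν = 1 / 16 := by
    rw [hν_def, hc_def, pow_succ, mul_comm ((1 / 256 : ℝ) ^ (2 * k + 1)) (1 / 256),
      mul_div_mul_right _ _ hq0.ne']
    norm_num
  have h1 : ∫ ω in Ioc 0 c, ν / (ν ^ 2 + ω ^ 2) = Real.arctan (1 / 16) := by
    rw [setIntegral_Ioc_poissonKernel hν hc0, e4, zero_div, Real.arctan_zero, sub_zero]
  have h2 : ∫ ω in Icc d 1, ν / (ν ^ 2 + ω ^ 2) ≤ Real.arctan (1 / 16) := by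
    rw [setIntegral_Icc_poissonKernel hν hd1, e3]
    have harc : Real.arctan 16 = Real.pi / 2 - Real.arctan (1 / 16) := by
      rw [← Real.arctan_inv_of_pos (show (0 : ℝ) < 1 / 16 by norm_num)]
      norm_num
    have := Real.arctan_lt_pi_div_two (1 / ν)
    linarith
  have hsmall : Real.arctan (1 / 16) ≤ 1 / 16 := by
    -- `arctan x ≤ x` for `x ≥ 0` (as `Literature.NumberTheory.LFunctions.arctan_le_self`, inlined to keep the
    -- import closure of this file inside the heat-conduction cone)
    have h1 : 0 ≤ Real.arctan (1 / 16) := Real.arctan_nonneg.2 (by norm_num)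
    have h2 := Real.le_tan h1 (Real.arctan_lt_pi_div_two _)
    rwa [Real.tan_arctan] at h2
  rw [hsplit] at hmono
  linarith

/-! ## §4 The witness and the refuted strengthening -/

/-- **A finite positive measure with oscillating Poisson means.** There is a finite (positive) Borel measure `ρ`
on `ℝ` whose Poisson means `ν ↦ ∫ ν/(ν²+ω²) dρ(ω)` neither converge in `ℝ` nor tend to `+∞` as `ν ↓ 0`:
Lebesgue measure on the lacunary shells `⋃ₖ [256^{-(2k+1)}, 256^{-2k}]`.  This is the recorded failure mode of
`CoercivePulse.AbelRegularity` ("lacunary spectral mass at `ω = 0`") as a theorem about free-standing measures: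
positive type of `C_T` (Bochner) and Fatou's radial lemma alone do not give the crux. [folklore] -/
theorem exists_isFiniteMeasure_poissonMeans_oscillate :
    ∃ ρ : Measure ℝ, IsFiniteMeasure ρ ∧
      ¬ ((∃ L : ℝ, Tendsto (fun ν : ℝ => ∫ ω, ν / (ν ^ 2 + ω ^ 2) ∂ρ) (𝓝[>] 0) (𝓝 L)) ∨
          Tendsto (fun ν : ℝ => ∫ ω, ν / (ν ^ 2 + ω ^ 2) ∂ρ) (𝓝[>] 0) atTop) := by
  refine ⟨(volume : Measure ℝ).restrict
      (⋃ k : ℕ, Icc ((1 / 256 : ℝ) ^ (2 * k + 1)) ((1 / 256 : ℝ) ^ (2 * k))),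
    isFiniteMeasure_restrict_lacunaryShells, ?_⟩
  -- the two test sequences tend to `0` from the right
  have hpow : Tendsto (fun n : ℕ => (1 / 256 : ℝ) ^ n) atTop (𝓝 0) :=
    tendsto_pow_atTop_nhds_zero_of_lt_one (by norm_num) (by norm_num)
  have h2k : Tendsto (fun k : ℕ => 2 * k) atTop atTop :=
    Filter.tendsto_atTop_atTop.2 fun b => ⟨b, fun a ha => by omega⟩
  have h2k1 : Tendsto (fun k : ℕ => 2 * k + 1) atTop atTop :=
    Filter.tendsto_atTop_atTop.2 fun b => ⟨b, fun a ha => by omega⟩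
  have hν : Tendsto (fun k : ℕ => (1 / 16 : ℝ) * (1 / 256 : ℝ) ^ (2 * k)) atTop (𝓝[>] 0) := by
    refine tendsto_nhdsWithin_iff.2 ⟨?_, Eventually.of_forall fun k => ?_⟩
    · have h := (hpow.comp h2k).const_mul (1 / 16 : ℝ)
      rw [mul_zero] at h
      exact h
    · exact mem_Ioi.2 (by positivity)
  have hν' : Tendsto (fun k : ℕ => (1 / 16 : ℝ) * (1 / 256 : ℝ) ^ (2 * k + 1)) atTop (𝓝[>] 0) := by
    refine tendsto_nhdsWithin_iff.2 ⟨?_, Eventually.of_forall fun k => ?_⟩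
    · have h := (hpow.comp h2k1).const_mul (1 / 16 : ℝ)
      rw [mul_zero] at h
      exact h
    · exact mem_Ioi.2 (by positivity)
  rintro (⟨L, hL⟩ | htop)
  · have hlo : Real.pi / 2 - 1 / 8 ≤ L :=
      ge_of_tendsto (hL.comp hν) (Eventually.of_forall fun k => poissonMeans_lacunary_ge k)
    have hhi : L ≤ 1 / 8 :=
      le_of_tendsto (hL.comp hν') (Eventually.of_forall fun k => poissonMeans_lacunary_le k)
    linarith [Real.pi_gt_three]
  · obtain ⟨k, hk⟩ := ((htop.comp hν').eventually_ge_atTop 1).exists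
    have := poissonMeans_lacunary_le k
    exact absurd (hk.trans this) (by norm_num)

/-- **The natural strengthening of `AbelRegularity` is false**: it is NOT the case that the Poisson means of
every finite positive measure on `ℝ` converge in `ℝ` or tend to `+∞` at `0⁺`.  (By the line's S1 the crux's Abel
means are such Poisson means; so the crux is a statement about THE current spectral measure of the chain, not a
consequence of stationarity / positive type.) [folklore] -/
theorem not_poissonMeans_dichotomy :
    ¬ ∀ ρ : Measure ℝ, IsFiniteMeasure ρ →
      ((∃ L : ℝ, Tendsto (fun ν : ℝ => ∫ ω, ν / (ν ^ 2 + ω ^ 2) ∂ρ) (𝓝[>] 0) (𝓝 L)) ∨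
          Tendsto (fun ν : ℝ => ∫ ω, ν / (ν ^ 2 + ω ^ 2) ∂ρ) (𝓝[>] 0) atTop) := by
  intro h
  obtain ⟨ρ, hρ, hnot⟩ := exists_isFiniteMeasure_poissonMeans_oscillate
  exact hnot (h ρ hρ)

/-! ## §5 The a.e.-carrier clause of `PreservesMeasure` is load-bearing -/

/-- **`AbelRegularity` without the a.e.-carrier clause is false.** Replace `D.PreservesMeasure μ` by its
second clause `∀ t, MeasurePreserving (D.flow t) μ μ` (so that nothing ties `D.flow` to Newton's equations:
`InfiniteChainDynamics` constrains the flow on its carrier only): the resulting statement fails at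
`ω₂ = lam = β = γ = T = 1`, for the shift-invariant superstable DLR state `μ` (momentum-reversal invariant by
uniqueness in its class) and the FROZEN dynamics with empty carrier and flow `φ_t = R` (momentum reversal) at
every `t`: `R` preserves `μ`, commutes with the shift, flips every bond current, and the static current variance
`c₀ = Σₓ ∫ j₀ jₓ dμ = C_T(0)` of the genuine chain is `> 0` (landed `stub_currentVariancePos`), so the frozen
correlation is the constant `-c₀ < 0`, its Abel means are `-c₀/ν → -∞`, and the dichotomy fails.  Any proof of
the crux must therefore USE that `μ`-a.e. orbit of `D` solves the equations of motion. [folklore] -/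
theorem abelRegularity_false_without_carrierAE :
    ¬ (∀ ω₂ lam β γ : ℝ, 0 < ω₂ → 0 < lam → 0 < β → ∀ T : ℝ, 0 < T →
        ∀ μ : Measure ChainConfig,
          (pinnedChain ω₂ lam β γ).IsChainGibbsMeasure T μ → IsShiftInvariant μ →
          μ.map (fun σ : ChainConfig => fun x : ℤ => ((σ x).1, -(σ x).2)) = μ →
          ∀ D : InfiniteChainDynamics (pinnedChain ω₂ lam β γ),
            (∀ t : ℝ, MeasurePreserving (D.flow t) μ μ) →
            (∀ t : ℝ, ∀ᵐ σ ∂μ, D.flow t (shift σ) = shift (D.flow t σ)) →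
            (∀ t : ℝ, D.HasAbsConvergentCorrelation μ t) →
            (∀ ν : ℝ, 0 < ν →
              IntegrableOn (fun t : ℝ => Real.exp (-(ν * t)) * D.currentCorrelation μ t) (Ioi 0)) →
            ((∃ L : ℝ, Tendsto (fun ν : ℝ => ∫ t in Ioi (0:ℝ), Real.exp (-(ν * t)) * D.currentCorrelation μ t)
                (𝓝[>] 0) (𝓝 L)) ∨
              Tendsto (fun ν : ℝ => ∫ t in Ioi (0:ℝ), Real.exp (-(ν * t)) * D.currentCorrelation μ t)
                (𝓝[>] 0) atTop)) := by
  intro h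
  set P := pinnedChain 1 1 1 1 with hP
  obtain ⟨μ, hG, hS, hss⟩ :=
    OscillatorChain.exists_isChainGibbsMeasure_shiftInvariant_superstable_pinnedChain (1:ℝ) one_pos
      zero_le_one zero_le_one one_pos (ω₂ := 1) (lam := 1) (β := 1) (T := 1)
  -- reversal invariance from uniqueness of the shift-invariant DLR state
  have huniq : ∀ μ₁ μ₂ : Measure ChainConfig,
      P.IsChainGibbsMeasure 1 μ₁ → IsShiftInvariant μ₁ → P.HasSuperstabilityEstimate μ₁ →
      P.IsChainGibbsMeasure 1 μ₂ → IsShiftInvariant μ₂ → P.HasSuperstabilityEstimate μ₂ → μ₁ = μ₂ :=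
    fun μ₁ μ₂ h₁ s₁ _ h₂ s₂ _ =>
      OscillatorChain.eq_of_isChainGibbsMeasure_of_isShiftInvariant_pinnedChain 1 one_pos zero_le_one
        zero_le_one one_pos h₁ s₁ h₂ s₂
  have hR : μ.map momentumReversalZ = μ :=
    OscillatorChain.map_momentumReversalZ_eq_of_regular_unique hG hS hss huniq
  have hRmp : MeasurePreserving momentumReversalZ μ μ :=
    OscillatorChain.measurePreserving_momentumReversalZ_of_map_eq hR
  -- chain data
  have hU1 : OscillatorChain.IsEvenPolyOfDegree P.U 2 :=
    OscillatorChain.pinnedChain_isEvenPolyOfDegree_U (1:ℝ) (1:ℝ) zero_le_one one_pos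
  have hV1 : OscillatorChain.IsEvenPolyOfDegree P.V 2 :=
    OscillatorChain.pinnedChain_isEvenPolyOfDegree_V (1:ℝ) (1:ℝ) (1:ℝ) one_pos
  have hU0 : ∀ r, 0 ≤ P.U r := OscillatorChain.pinnedChain_U_nonneg 1 1 zero_le_one zero_le_one
  have hUm : Measurable P.U := OscillatorChain.measurable_pinnedChain_U 1 1 1 1
  -- the static current variance `c₀ = C(0) > 0`, through the genuine (Buttà–Marchioro) dynamics
  obtain ⟨D₀, hcar, -, -, -, -, -, hpres⟩ := OscillatorChain.exists_bmDynamics (by norm_num) (by norm_num) hU1 hV1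
  have hD₀ : D₀.PreservesMeasure μ := hpres 1 μ hG hss
  have hpos : 0 < D₀.currentCorrelation μ 0 :=
    GreenKuboContinuation.TemperatureBlindVitaliHurwitz.stub_currentVariancePos 1 1 1 1 one_pos one_pos
      one_pos one_pos D₀ hcar 1 one_pos μ hG hS hss hD₀
  set c₀ : ℝ := ∑' x : ℤ, ∫ σ, P.bondCurrentZ σ 0 * P.bondCurrentZ σ x ∂μ with hc₀
  have hc₀eq : D₀.currentCorrelation μ 0 = c₀ := by
    rw [hc₀]
    unfold InfiniteChainDynamics.currentCorrelation
    exact tsum_congr fun x => integral_congr_ae (D₀.bondCurrentZ_mul_flow_zero_ae_eq hD₀ x)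
  have hc₀pos : 0 < c₀ := hc₀eq ▸ hpos
  -- sign flip of the static products under `R`
  have hflip : ∀ x : ℤ, ∫ σ, P.bondCurrentZ σ 0 * P.bondCurrentZ (momentumReversalZ σ) x ∂μ =
      -∫ σ, P.bondCurrentZ σ 0 * P.bondCurrentZ σ x ∂μ := fun x => by
    rw [← integral_neg]
    refine integral_congr_ae (Eventually.of_forall fun σ => ?_)
    simp only [bondCurrentZ_momentumReversalZ, mul_neg]
  have hsum_flip : Summable fun x : ℤ =>
      |∫ σ, P.bondCurrentZ σ 0 * P.bondCurrentZ (momentumReversalZ σ) x ∂μ| :=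
    (hG.summable_abs_integral_bondCurrentZ_mul).congr fun x => by rw [hflip x, abs_neg]
  -- the frozen reversal dynamics (empty carrier, `φ_t = R`)
  obtain ⟨D, hDflow⟩ : ∃ D : InfiniteChainDynamics P, ∀ (t : ℝ) (σ : ChainConfig),
      D.flow t σ = momentumReversalZ σ :=
    ⟨⟨∅, fun _ => momentumReversalZ, fun _ => mapsTo_empty _ _, fun _ h => (notMem_empty _ h).elim,
      fun _ h => (notMem_empty _ h).elim, fun _ hγ _ _ => (notMem_empty _ (hγ 0)).elim⟩, fun _ _ => rfl⟩
  have hflow : ∀ t : ℝ, D.flow t = momentumReversalZ := fun t => funext (hDflow t)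
  have hC : ∀ t : ℝ, D.currentCorrelation μ t = -c₀ := fun t => by
    unfold InfiniteChainDynamics.currentCorrelation
    rw [hflow t, hc₀, ← tsum_neg]
    exact tsum_congr hflip
  have hmp : ∀ t : ℝ, MeasurePreserving (D.flow t) μ μ := fun t => by rw [hflow t]; exact hRmp
  have hcov : ∀ t : ℝ, ∀ᵐ σ ∂μ, D.flow t (shift σ) = shift (D.flow t σ) := fun t =>
    Eventually.of_forall fun σ => by rw [hDflow, hDflow]; exact (shift_momentumReversalZ σ).symm
  have hAC : ∀ t : ℝ, D.HasAbsConvergentCorrelation μ t := fun t => by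
    unfold InfiniteChainDynamics.HasAbsConvergentCorrelation
    rw [hflow t]
    exact ⟨fun x => hss.integrable_bondCurrentZ_mul_comp one_le_two hU0 hUm hV1 hRmp x 0, hsum_flip⟩
  have hInt : ∀ ν : ℝ, 0 < ν →
      IntegrableOn (fun t : ℝ => Real.exp (-(ν * t)) * D.currentCorrelation μ t) (Ioi 0) := fun ν hν => by
    simp_rw [hC]
    have h1 : IntegrableOn (fun t : ℝ => Real.exp (-(ν * t))) (Ioi 0) := by
      simpa only [neg_mul] using exp_neg_integrableOn_Ioi 0 hν
    exact h1.mul_const _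
  have hdich := h 1 1 1 1 one_pos one_pos one_pos 1 one_pos μ hG hS hR D hmp hcov hAC hInt
  -- the Abel means of the frozen dynamics are `-c₀/ν → -∞`
  have hval : ∀ ν : ℝ, 0 < ν →
      ∫ t in Ioi (0:ℝ), Real.exp (-(ν * t)) * D.currentCorrelation μ t = -(c₀ * ν⁻¹) := fun ν hν => by
    simp_rw [hC]
    rw [integral_mul_const]
    have h1 : ∫ t in Ioi (0:ℝ), Real.exp (-(ν * t)) = ν⁻¹ := by
      rw [show (fun t : ℝ => Real.exp (-(ν * t))) = fun t => Real.exp (-ν * t) from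
        funext fun t => by rw [neg_mul], integral_exp_mul_Ioi (neg_lt_zero.mpr hν) 0, mul_zero,
        Real.exp_zero, neg_div, one_div, inv_neg, neg_neg]
    rw [h1]
    ring
  have hbot : Tendsto (fun ν : ℝ => ∫ t in Ioi (0:ℝ), Real.exp (-(ν * t)) * D.currentCorrelation μ t)
      (𝓝[>] 0) atBot := by
    have h1 : Tendsto (fun ν : ℝ => -(c₀ * ν⁻¹)) (𝓝[>] 0) atBot :=
      tendsto_neg_atTop_atBot.comp (tendsto_inv_nhdsGT_zero.const_mul_atTop hc₀pos)
    exact h1.congr' ((eventually_mem_nhdsWithin).mono fun ν hν => (hval ν hν).symm)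
  rcases hdich with ⟨L, hL⟩ | htop
  · exact not_tendsto_nhds_of_tendsto_atBot hbot L hL
  · exact hbot.not_tendsto disjoint_atBot_atTop htop

end Summit.AtomisticToContinuum.FouriersLaw.Theorems.AbelRegularity.Negative

end
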